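import Summits.QuantumFields.YangMills.Theorems.AllWindowsColdBoxBoxHighLineTiltCum3Split

/-!
# T-S5.13 (e4) — the third cumulant at `t = 0` on `μ_D` is bounded by FOUR Hölder sizes (ASSEMBLY-S5 §6 (e4))

Continuation of ✓`…TiltCum3Split` (the exact parity split of `κ₃,₀`).  Observables bounded only ON the small-field set are truncated by `sfInd` (they agree
`μ_D`-a.e., ✓`Tilt.ae_muD_mem_smallField`), so w5 g22's global-bound Hölder lemma ✓`Tilt.abs_tiltExp_mul_mul_le` (`L⁴·L⁴·L²`) applies:

* `tiltExp_muD_congr_on` — `E_t[G]` over `μ_D` depends only on `G|_D`;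
* ★`abs_tiltExp_muD_triple_le` — `|E_t[XYZ]| ≤ √(√E_t[X⁴]·√E_t[Y⁴])·√E_t[Z²]` over `μ_D` for `X, Y, Z` measurable and bounded on `smallField H s`;
* ★★`abs_tiltCum3_muD_zero_le` — `|κ₃,₀(E₁+O₁, E₂+O₂, U_e+U_o)| ≤ T(Ẽ₁,Ẽ₂,Ũ_e) + T(Ẽ₁,O₂,U_o) + T(O₁,Ẽ₂,U_o) + T(O₁,O₂,Ũ_e)`,
  `T(X,Y,Z) := √(√E_0[X⁴]·√E_0[Y⁴])·√E_0[Z²]` — the sizes are then ✓12a/✓12d/✓12e (Gaussian moments, transferred to `E_0 = R(·)` by ✓6g) and 13K-U / ✓13s.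

Tree (✓TiltCum3Split) + Mathlib; no definitions.  HONEST LABEL: bookkeeping for the T-S5.13 assembly of the XL stub S5 of a critic-PASSed DRAFT line; T-S5.13/S5, U5, ⟨24004⟩ ⟨24335⟩
⟨24336⟩ remain OPEN; route AllWindowsColdBox is DRAFT; no rung is proved; the Yang–Mills mass gap is NOT proved by this file.
Seat ym-line-sfw-p2 g77 (LEAD, cell ym-idea-1; T-S5.13 assembler of record).
-/

set_option autoImplicit false

noncomputable section

open MeasureTheory Set
open scoped ENNReal

namespace Summit.QuantumFields.YangMills.Theorems.AllWindowsColdBoxBoxHighLine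

namespace Tilt

variable (H : ℕ)

/-- `E_t[G]` over `μ_D` depends only on the values of `G` on the small-field set. -/
theorem tiltExp_muD_congr_on (β s : ℝ) (U : (LandauFree H → E3) → ℝ) (t : ℝ) {G G' : (LandauFree H → E3) → ℝ}
    (h : ∀ a ∈ smallField H s, G a = G' a) :
    tiltExp ((volume.restrict (smallField H s)).withDensity fun a => ENNReal.ofReal (gaussWeight β H a)) U t G =
      tiltExp ((volume.restrict (smallField H s)).withDensity fun a => ENNReal.ofReal (gaussWeight β H a)) U t G' := by
  unfold tiltExp
  congr 1
  refine integral_congr_ae ((ae_muD_mem_smallField H β s).mono fun a ha => ?_)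
  simp only [h a ha]

/-- ★ **Hölder `L⁴·L⁴·L²` over `μ_D` for observables bounded on `D`**: `|E_t[XYZ]| ≤ √(√E_t[X⁴]·√E_t[Y⁴])·√E_t[Z²]`. -/
theorem abs_tiltExp_muD_triple_le (β s : ℝ) (U : (LandauFree H → E3) → ℝ) (t : ℝ) {X Y Z : (LandauFree H → E3) → ℝ} {B : ℝ} (hB : 0 ≤ B)
    (mX : Measurable X) (mY : Measurable Y) (mZ : Measurable Z)
    (bX : ∀ a ∈ smallField H s, |X a| ≤ B) (bY : ∀ a ∈ smallField H s, |Y a| ≤ B) (bZ : ∀ a ∈ smallField H s, |Z a| ≤ B) :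
    |tiltExp ((volume.restrict (smallField H s)).withDensity fun a => ENNReal.ofReal (gaussWeight β H a)) U t (fun a => X a * Y a * Z a)| ≤
      Real.sqrt (Real.sqrt (tiltExp ((volume.restrict (smallField H s)).withDensity fun a => ENNReal.ofReal (gaussWeight β H a)) U t (fun a => X a ^ 4)) *
          Real.sqrt (tiltExp ((volume.restrict (smallField H s)).withDensity fun a => ENNReal.ofReal (gaussWeight β H a)) U t (fun a => Y a ^ 4))) *
        Real.sqrt (tiltExp ((volume.restrict (smallField H s)).withDensity fun a => ENNReal.ofReal (gaussWeight β H a)) U t (fun a => Z a ^ 2)) := by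
  -- truncations
  have hon : ∀ a ∈ smallField H s, sfInd H s a = 1 := fun a ha => by unfold sfInd; exact Set.indicator_of_mem ha _
  have eXYZ : ∀ a ∈ smallField H s, X a * Y a * Z a = (sfInd H s a * X a) * (sfInd H s a * Y a) * (sfInd H s a * Z a) :=
    fun a ha => by rw [hon a ha]; ring
  have eX : ∀ a ∈ smallField H s, X a ^ 4 = (sfInd H s a * X a) ^ 4 := fun a ha => by rw [hon a ha, one_mul]
  have eY : ∀ a ∈ smallField H s, Y a ^ 4 = (sfInd H s a * Y a) ^ 4 := fun a ha => by rw [hon a ha, one_mul]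
  have eZ : ∀ a ∈ smallField H s, Z a ^ 2 = (sfInd H s a * Z a) ^ 2 := fun a ha => by rw [hon a ha, one_mul]
  rw [tiltExp_muD_congr_on H β s U t eXYZ, tiltExp_muD_congr_on H β s U t eX, tiltExp_muD_congr_on H β s U t eY, tiltExp_muD_congr_on H β s U t eZ]
  exact abs_tiltExp_mul_mul_le ((measurable_sfInd H s).mul mX) ((measurable_sfInd H s).mul mY) ((measurable_sfInd H s).mul mZ)
    (abs_sfInd_mul_le H hB bX) (abs_sfInd_mul_le H hB bY) (abs_sfInd_mul_le H hB bZ) U t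

/-- `|E_0[F]| ≤ B` over `μ_D` for `F` with `|F| ≤ B` on the small-field set (`D` of positive Gaussian mass). -/
theorem abs_tiltExp_muD_zero_le {β : ℝ} (hβ : 0 < β) (s : ℝ) (U : (LandauFree H → E3) → ℝ) (hD : 0 < ∫ a, sfInd H s a * gaussWeight β H a)
    {F : (LandauFree H → E3) → ℝ} {B : ℝ} (hB : 0 ≤ B) (hF : ∀ a ∈ smallField H s, |F a| ≤ B) :
    |tiltExp ((volume.restrict (smallField H s)).withDensity fun a => ENNReal.ofReal (gaussWeight β H a)) U 0 F| ≤ B := by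
  rw [tiltExp_muD_zero_eq H hβ]
  have hZ := EdgeChartGaussian.integral_gaussWeight_pos H hβ
  have hpos : 0 < gaussAvg β H (sfInd H s) := by unfold gaussAvg; exact div_pos hD hZ
  rw [abs_div, abs_of_pos hpos, div_le_iff₀ hpos]
  have h1 : |gaussAvg β H (fun a => sfInd H s a * F a)| ≤ gaussAvg β H (fun a => |sfInd H s a * F a|) := by
    unfold gaussAvg
    rw [abs_div, abs_of_pos hZ]
    refine div_le_div_of_nonneg_right ?_ hZ.le
    refine (abs_integral_le_integral_abs).trans (le_of_eq (integral_congr_ae (Filter.Eventually.of_forall fun a => ?_)))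
    simp only [abs_mul, abs_of_pos (EdgeChartGaussian.gaussWeight_pos β H a)]
  have h2 : gaussAvg β H (fun a => |sfInd H s a * F a|) ≤ gaussAvg β H (fun a => B * sfInd H s a) := by
    have hIb : Integrable fun a : LandauFree H → E3 => B * sfInd H s a * gaussWeight β H a := by
      refine integrable_bdd_mul_gaussWeight H hβ ((measurable_sfInd H s).const_mul B) (C := B) fun a => ?_
      unfold sfInd
      by_cases ha : a ∈ smallField H s
      · rw [Set.indicator_of_mem ha, mul_one, abs_of_nonneg hB]
      · rw [Set.indicator_of_notMem ha, mul_zero, abs_zero]; exact hB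
    refine EdgeChartGaussian.gaussAvg_mono_of_nonneg H hβ (fun a => abs_nonneg _) (fun a => ?_) hIb
    unfold sfInd
    by_cases ha : a ∈ smallField H s
    · rw [Set.indicator_of_mem ha, one_mul, mul_one]; exact hF a ha
    · rw [Set.indicator_of_notMem ha, zero_mul, abs_zero, mul_zero]
  rw [EdgeChartGaussian.gaussAvg_const_mul] at h2
  exact h1.trans h2

/-- ★★ **(e4) bound**: with the hypotheses of ✓`tiltCum3_muD_zero_parity_split`,
`|κ₃,₀(E₁+O₁, E₂+O₂, U_e+U_o)| ≤ T(Ẽ₁,Ẽ₂,Ũ_e) + T(Ẽ₁,O₂,U_o) + T(O₁,Ẽ₂,U_o) + T(O₁,O₂,Ũ_e)`, `T(X,Y,Z) = √(√E_0[X⁴]·√E_0[Y⁴])·√E_0[Z²]`. -/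
theorem abs_tiltCum3_muD_zero_le {β : ℝ} (hβ : 0 < β) (s : ℝ) (hD : 0 < ∫ a, sfInd H s a * gaussWeight β H a)
    {E₁ O₁ E₂ O₂ Ue Uo : (LandauFree H → E3) → ℝ} {B : ℝ} (hB : 0 ≤ B)
    (mE₁ : Measurable E₁) (mO₁ : Measurable O₁) (mE₂ : Measurable E₂) (mO₂ : Measurable O₂) (mUe : Measurable Ue) (mUo : Measurable Uo)
    (bE₁ : ∀ a ∈ smallField H s, |E₁ a| ≤ B) (bO₁ : ∀ a ∈ smallField H s, |O₁ a| ≤ B) (bE₂ : ∀ a ∈ smallField H s, |E₂ a| ≤ B)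
    (bO₂ : ∀ a ∈ smallField H s, |O₂ a| ≤ B) (bUe : ∀ a ∈ smallField H s, |Ue a| ≤ B) (bUo : ∀ a ∈ smallField H s, |Uo a| ≤ B)
    (pE₁ : ∀ a, E₁ (-a) = E₁ a) (pO₁ : ∀ a, O₁ (-a) = -O₁ a) (pE₂ : ∀ a, E₂ (-a) = E₂ a) (pO₂ : ∀ a, O₂ (-a) = -O₂ a)
    (pUe : ∀ a, Ue (-a) = Ue a) (pUo : ∀ a, Uo (-a) = -Uo a) :
    let μD : Measure (LandauFree H → E3) := (volume.restrict (smallField H s)).withDensity fun a => ENNReal.ofReal (gaussWeight β H a)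
    let U : (LandauFree H → E3) → ℝ := fun a => Ue a + Uo a
    let T : ((LandauFree H → E3) → ℝ) → ((LandauFree H → E3) → ℝ) → ((LandauFree H → E3) → ℝ) → ℝ := fun X Y Z =>
      Real.sqrt (Real.sqrt (tiltExp μD U 0 (fun a => X a ^ 4)) * Real.sqrt (tiltExp μD U 0 (fun a => Y a ^ 4))) * Real.sqrt (tiltExp μD U 0 (fun a => Z a ^ 2))
    |tiltCum3 μD U 0 (fun a => E₁ a + O₁ a) (fun a => E₂ a + O₂ a)| ≤
      T (fun a => E₁ a - tiltExp μD U 0 E₁) (fun a => E₂ a - tiltExp μD U 0 E₂) (fun a => Ue a - tiltExp μD U 0 Ue) +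
      T (fun a => E₁ a - tiltExp μD U 0 E₁) O₂ Uo + T O₁ (fun a => E₂ a - tiltExp μD U 0 E₂) Uo +
      T O₁ O₂ (fun a => Ue a - tiltExp μD U 0 Ue) := by
  intro μD U T
  have hsplit := tiltCum3_muD_zero_parity_split H hβ s hD hB mE₁ mO₁ mE₂ mO₂ mUe mUo bE₁ bO₁ bE₂ bO₂ bUe bUo pE₁ pO₁ pE₂ pO₂ pUe pUo
  simp only at hsplit
  rw [show tiltCum3 μD U 0 (fun a => E₁ a + O₁ a) (fun a => E₂ a + O₂ a) = _ from hsplit]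
  -- bounds of the means and of the centred factors (by 2B) on D
  have mean_le : ∀ {F : (LandauFree H → E3) → ℝ}, (∀ a ∈ smallField H s, |F a| ≤ B) → |tiltExp μD U 0 F| ≤ B :=
    fun hF => abs_tiltExp_muD_zero_le H hβ s U hD hB hF
  have b2 : ∀ {F : (LandauFree H → E3) → ℝ}, (∀ a ∈ smallField H s, |F a| ≤ B) → ∀ a ∈ smallField H s, |F a| ≤ 2 * B :=
    fun hF a ha => (hF a ha).trans (by linarith)
  have cen : ∀ {F : (LandauFree H → E3) → ℝ}, (∀ a ∈ smallField H s, |F a| ≤ B) →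
      ∀ a ∈ smallField H s, |F a - tiltExp μD U 0 F| ≤ 2 * B := by
    intro F hF a ha
    have := (abs_sub _ _).trans (add_le_add (hF a ha) (mean_le hF)); linarith
  have hB2 : 0 ≤ 2 * B := by linarith
  have t1 := abs_tiltExp_muD_triple_le H β s U 0 hB2 (mE₁.sub measurable_const) (mE₂.sub measurable_const) (mUe.sub measurable_const)
    (cen bE₁) (cen bE₂) (cen bUe)
  have t2 := abs_tiltExp_muD_triple_le H β s U 0 hB2 (mE₁.sub measurable_const) mO₂ mUo (cen bE₁) (b2 bO₂) (b2 bUo)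
  have t3 := abs_tiltExp_muD_triple_le H β s U 0 hB2 mO₁ (mE₂.sub measurable_const) mUo (b2 bO₁) (cen bE₂) (b2 bUo)
  have t4 := abs_tiltExp_muD_triple_le H β s U 0 hB2 mO₁ mO₂ (mUe.sub measurable_const) (b2 bO₁) (b2 bO₂) (cen bUe)
  refine (abs_add_le _ _).trans (add_le_add ((abs_add_le _ _).trans (add_le_add ((abs_add_le _ _).trans (add_le_add t1 t2)) t3)) t4)

end Tilt

end Summit.QuantumFields.YangMills.Theorems.AllWindowsColdBoxBoxHighLine

end
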